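import Literature.Analysis.ValidatedNumerics.TaylorModelExpr
import HarnessLib

/-!
# Polynomials with Taylor-model coefficients evaluated at COMPLEX points: enclosures on a complex disc

Trunk T-ANA (Analysis/ValidatedNumerics); namespace `Literature.Analysis.ValidatedNumerics.PolyMP`.
Sequel of `TaylorModelPoly.lean` / `TaylorModelExpr.lean`. A validated ANALYTIC CONTINUATION certificate works with a
polynomial `ŷ(t) = Σ aₖ(ρ) tᵏ` in a COMPLEX variable `t` (time in a complex disc) whose coefficients `aₖ` are real and depend on
a parameter `ρ` (here: Taylor models, `TPMem`). This file supplies the complex-evaluation layer that turns such data into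
kernel-checked inequalities on a whole complex disc `‖t‖ ≤ R`:
* `evalC as t` (Horner evaluation of a real coefficient list at `t : ℂ`) with the ring-homomorphism properties
  `evalC_addR`, `evalC_smulR`, `evalC_mulR`, `evalC_map_neg`, realness `evalC_ofReal`, and the complex derivative
  `hasDerivAt_evalC` (derivative = `evalC (derR as)`);
* the generic formal derivative `derL` of coefficient lists over any type (at `ℝ` it is `derR`, at functions it commutes with
  evaluation in the parameter: `evalAt_derL`) and its Taylor-model version `tpder` with `tpmem_der`;
* DISC BOUNDS: `norm_evalC_le_absBoundR` (`‖Σ aₖtᵏ‖ ≤ Σ|aₖ|Rᵏ` for `‖t‖ ≤ R`), the lower bound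
  `norm_evalC_cons_ge` (`‖a₀ + t·p(t)‖ ≥ |a₀| − R·Σ|pₖ|Rᵏ`), and the kernel-computable, parameter-uniform forms
  `norm_evalC_le_of_tpmem` / `norm_evalC_ge_of_tpmem` reading the integer bound `absBoundI` of `IntervalPolynomial.lean` off the
  `TPoly` after `tboundI` (one `decide` in applications).
Problem-independent (written for the complex-disc certificates of the Buckmaster–Cao-Labora–Gómez-Serrano profile); no facts.

## References

* K. Makino, M. Berz, *Taylor models and other validated functional inclusion methods*, Int. J. Pure Appl. Math. 4 (2003). [folklore]
* R. E. Moore, *Interval Analysis*, Prentice-Hall (1966), Ch. 3, Ch. 10. [cite: Moore1966, Theorem 3.1]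
-/

namespace Literature.Analysis.ValidatedNumerics

namespace PolyMP

open Literature.Analysis.ValidatedNumerics.NumericsMP

/-! ### Complex Horner evaluation of a real coefficient list -/

/-- `a₀ + t(a₁ + t(a₂ + …))` at a complex point `t`. [folklore] -/
noncomputable def evalC : List ℝ → ℂ → ℂ
  | [], _ => 0
  | a :: as, t => (a : ℂ) + t * evalC as t

/-- [folklore] -/
@[simp] theorem evalC_nil (t : ℂ) : evalC [] t = 0 := rfl

/-- [folklore] -/
@[simp] theorem evalC_cons (a : ℝ) (as : List ℝ) (t : ℂ) : evalC (a :: as) t = (a : ℂ) + t * evalC as t := rfl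

/-- On real points `evalC` is `evalR`. [folklore] -/
theorem evalC_ofReal : ∀ (as : List ℝ) (x : ℝ), evalC as (x : ℂ) = (evalR as x : ℂ)
  | [], x => by simp
  | a :: as, x => by rw [evalC_cons, evalR_cons, evalC_ofReal as x]; push_cast; ring

/-- [folklore] -/
theorem evalC_addR : ∀ (as bs : List ℝ) (t : ℂ), evalC (addR as bs) t = evalC as t + evalC bs t
  | [], bs, t => by simp [addR]
  | a :: as, [], t => by simp [addR]
  | a :: as, b :: bs, t => by
      simp only [addR, evalC_cons, evalC_addR as bs t]; push_cast; ring

/-- [folklore] -/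
theorem evalC_smulR (c : ℝ) : ∀ (as : List ℝ) (t : ℂ), evalC (smulR c as) t = (c : ℂ) * evalC as t
  | [], t => by simp [smulR]
  | a :: as, t => by
      have h := evalC_smulR c as t
      simp only [smulR, List.map_cons, evalC_cons] at h ⊢
      rw [h]; push_cast; ring

/-- [folklore] -/
theorem evalC_mulR : ∀ (as bs : List ℝ) (t : ℂ), evalC (mulR as bs) t = evalC as t * evalC bs t
  | [], bs, t => by simp [mulR]
  | a :: as, bs, t => by
      simp only [mulR, evalC_addR, evalC_smulR, evalC_cons, evalC_mulR as bs t]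
      push_cast; ring

/-- [folklore] -/
theorem evalC_map_neg : ∀ (as : List ℝ) (t : ℂ), evalC (as.map Neg.neg) t = -evalC as t
  | [], t => by simp
  | a :: as, t => by simp only [List.map_cons, evalC_cons, evalC_map_neg as t]; push_cast; ring

/-- **Complex derivative of the evaluation**: `d/dt Σ aₖ tᵏ = evalC (derR as) t`. [folklore] -/
theorem hasDerivAt_evalC : ∀ (as : List ℝ) (t : ℂ), HasDerivAt (evalC as) (evalC (derR as) t) t
  | [], t => by
      simp only [derR, evalC_nil]
      exact (hasDerivAt_const t (0 : ℂ)).congr_of_eventuallyEq (Filter.Eventually.of_forall fun y => rfl)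
  | a :: as, t => by
      have ih := hasDerivAt_evalC as t
      have h1 : HasDerivAt (fun y : ℂ => (a : ℂ) + y * evalC as y) (0 + (1 * evalC as t + t * evalC (derR as) t)) t :=
        (hasDerivAt_const t (a : ℂ)).add ((hasDerivAt_id t).mul ih)
      have e : (fun y : ℂ => (a : ℂ) + y * evalC as y) = evalC (a :: as) := by funext y; rfl
      rw [e] at h1
      convert h1 using 1
      simp only [derR, evalC_addR, evalC_cons]; push_cast; ring

/-- [folklore] -/
theorem deriv_evalC (as : List ℝ) (t : ℂ) : deriv (evalC as) t = evalC (derR as) t := (hasDerivAt_evalC as t).deriv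

/-- [folklore] -/
theorem differentiable_evalC (as : List ℝ) : Differentiable ℂ (evalC as) := fun t => (hasDerivAt_evalC as t).differentiableAt

/-! ### Disc bounds -/

/-- **Upper bound on a complex disc**: `‖Σ aₖ tᵏ‖ ≤ absBound(a, R)` for `‖t‖ ≤ R`. [cite: Moore1966, Theorem 3.1] -/
theorem norm_evalC_le_absBoundR : ∀ (as : List ℝ) {t : ℂ} {R : ℝ}, ‖t‖ ≤ R → ‖evalC as t‖ ≤ absBoundR as R
  | [], t, R, _ => by simp [absBoundR]
  | a :: as, t, R, ht => by
      have hR : 0 ≤ R := (norm_nonneg t).trans ht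
      have ih := norm_evalC_le_absBoundR as ht
      have hb := absBoundR_nonneg as hR
      simp only [evalC_cons, absBoundR]
      calc ‖(a : ℂ) + t * evalC as t‖ ≤ ‖(a : ℂ)‖ + ‖t * evalC as t‖ := norm_add_le _ _
        _ = |a| + ‖t‖ * ‖evalC as t‖ := by rw [Complex.norm_real, Real.norm_eq_abs, norm_mul]
        _ ≤ |a| + R * absBoundR as R := by gcongr

/-- **Lower bound on a complex disc**: `‖a₀ + t·p(t)‖ ≥ |a₀| − R·absBound(p, R)` for `‖t‖ ≤ R`. [folklore] -/
theorem norm_evalC_cons_ge (a : ℝ) (as : List ℝ) {t : ℂ} {R : ℝ} (ht : ‖t‖ ≤ R) :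
    |a| - R * absBoundR as R ≤ ‖evalC (a :: as) t‖ := by
  have hR : 0 ≤ R := (norm_nonneg t).trans ht
  have h1 : ‖t * evalC as t‖ ≤ R * absBoundR as R := by
    rw [norm_mul]; exact mul_le_mul ht (norm_evalC_le_absBoundR as ht) (norm_nonneg _) hR
  have h2 : ‖(a : ℂ)‖ - ‖t * evalC as t‖ ≤ ‖(a : ℂ) + t * evalC as t‖ := by
    have := norm_sub_norm_le (a : ℂ) (-(t * evalC as t))
    rw [norm_neg, sub_neg_eq_add] at this
    exact this
  rw [Complex.norm_real, Real.norm_eq_abs] at h2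
  rw [evalC_cons]
  linarith

/-! ### The formal derivative, generically and for Taylor-model coefficients -/

section Generic

variable {α : Type*}

/-- Formal derivative of a coefficient list (same recursion as `derR`). [folklore] -/
def derL [Add α] [Zero α] : List α → List α
  | [] => []
  | _ :: as => addL as (0 :: derL as)

/-- [folklore] -/
theorem derL_real : ∀ (as : List ℝ), derL as = derR as
  | [] => rfl
  | a :: as => by simp [derL, derR, addL_real, derL_real as]

/-- [folklore] -/
theorem evalAt_derL (ρ : ℝ) : ∀ (fs : List (ℝ → ℝ)), evalAt ρ (derL fs) = derR (evalAt ρ fs)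
  | [] => rfl
  | f :: fs => by
      simp only [derL, derR, evalAt_addL, evalAt_cons, Pi.zero_apply, evalAt_derL ρ fs]

end Generic

/-- Taylor-model formal derivative. [folklore] -/
def tpder (S : ℕ) : TPoly → TPoly
  | [] => []
  | _ :: Ps => tpadd Ps (tzero S :: tpder S Ps)

/-- [folklore] -/
theorem tpmem_der {S : ℕ} {h : ℚ} : ∀ {fs : List (ℝ → ℝ)} {Ps : TPoly}, TPMem S h fs Ps → TPMem S h (derL fs) (tpder S Ps)
  | _, _, List.Forall₂.nil => by simpa [derL, tpder] using tpmem_nil S h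
  | _, _, List.Forall₂.cons (a := f) (b := P) (l₁ := fs) (l₂ := Ps) _ hP => by
      simp only [derL, tpder]
      exact tpmem_add hP (tpmem_cons (tmem_zero S h) (tpmem_der hP))

/-- A constant (parameter-independent) rational coefficient as a one-term list. [folklore] -/
def tpconst (S : ℕ) (q : ℚ) : TPoly := [tconst (ofRat S q)]

/-- [folklore] -/
theorem tpmem_tpconst (S : ℕ) (h : ℚ) (q : ℚ) : TPMem S h [fun _ => (q : ℝ)] (tpconst S q) :=
  tpmem_cons (tmem_const (S := S) (h := h) (mem_ofRat S q)) (tpmem_nil S h)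

/-- Integer multiple of every coefficient. [folklore] -/
def tpsmulInt (k : ℤ) (Ps : TPoly) : TPoly := Ps.map (tsmulInt k)

/-- [folklore] -/
theorem tpmem_smulInt {S : ℕ} {h : ℚ} (k : ℤ) : ∀ {fs : List (ℝ → ℝ)} {Ps : TPoly}, TPMem S h fs Ps →
    TPMem S h (fs.map fun f ρ => (k : ℝ) * f ρ) (tpsmulInt k Ps)
  | _, _, List.Forall₂.nil => List.Forall₂.nil
  | _, _, List.Forall₂.cons (a := f) (b := P) hf hP => by
      simp only [tpsmulInt, List.map_cons]
      exact List.Forall₂.cons (tmem_smulInt k hf) (tpmem_smulInt k hP)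

/-- Division of every coefficient by a positive natural number. [folklore] -/
def tpdivNat (n : ℕ) (Ps : TPoly) : TPoly := Ps.map (tdivNat n)

/-- [folklore] -/
theorem tpmem_divNat {S : ℕ} {h : ℚ} {n : ℕ} (hn : 0 < n) : ∀ {fs : List (ℝ → ℝ)} {Ps : TPoly}, TPMem S h fs Ps →
    TPMem S h (fs.map fun f ρ => f ρ / n) (tpdivNat n Ps)
  | _, _, List.Forall₂.nil => List.Forall₂.nil
  | _, _, List.Forall₂.cons (a := f) (b := P) hf hP => by
      simp only [tpdivNat, List.map_cons]
      exact List.Forall₂.cons (tmem_divNat hn hf) (tpmem_divNat hn hP)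

/-- Evaluation commutes with coefficientwise maps of the form `f ↦ (ρ ↦ φ (f ρ))`. [folklore] -/
theorem evalAt_map (ρ : ℝ) (φ : ℝ → ℝ) : ∀ (fs : List (ℝ → ℝ)),
    evalAt ρ (fs.map fun f ρ' => φ (f ρ')) = (evalAt ρ fs).map φ
  | [] => rfl
  | f :: fs => by simp only [List.map_cons, evalAt_cons, evalAt_map ρ φ fs]

/-- `evalC` of a mapped-by-scalar list. [folklore] -/
theorem evalC_map_mul (c : ℝ) (as : List ℝ) (t : ℂ) : evalC (as.map (c * ·)) t = (c : ℂ) * evalC as t :=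
  evalC_smulR c as t

/-! ### Parameter-uniform disc bounds read off a `TPoly` -/

/-- **Kernel-checkable upper bound on a complex disc, uniformly in the parameter.** If `TPMem S h fs Ps`, `|ρ| ≤ h` and
`‖t‖ ≤ Rn/Rd`, then `‖Σₖ fₖ(ρ) tᵏ‖ · S ≤ absBoundI S Rn Rd (Ps.map (tboundI S h))`. [cite: Moore1966, Theorem 3.1] -/
theorem norm_evalC_le_of_tpmem {S : ℕ} {h : ℚ} (h0 : 0 ≤ h) {fs : List (ℝ → ℝ)} {Ps : TPoly} (hP : TPMem S h fs Ps)
    {ρ : ℝ} (hρ : |ρ| ≤ h) {Rn : ℤ} {Rd : ℕ} (hRn : 0 ≤ Rn) (hRd : 0 < Rd) {t : ℂ} (ht : ‖t‖ ≤ (Rn : ℝ) / Rd) :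
    ‖evalC (evalAt ρ fs) t‖ * S ≤ (absBoundI S Rn Rd (Ps.map (tboundI S h)) : ℝ) := by
  have hmem := pmem_map_tboundI h0 hρ hP
  have h1 := norm_evalC_le_absBoundR (evalAt ρ fs) ht
  have h2 := absBoundR_le_absBoundI (S := S) hRn hRd hmem
  have hS0 : (0 : ℝ) ≤ S := by positivity
  calc ‖evalC (evalAt ρ fs) t‖ * S ≤ absBoundR (evalAt ρ fs) ((Rn : ℝ) / Rd) * S := mul_le_mul_of_nonneg_right h1 hS0
    _ ≤ _ := h2

/-- **Kernel-checkable lower bound on a complex disc, uniformly in the parameter**: for a list with head `f₀`,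
`‖Σₖ fₖ(ρ) tᵏ‖ · S ≥ tlowerI(|head|) − …`; stated as: `(L − Rn·absBoundI(tail)/Rd ≤ ‖evalC‖·S)` whenever `L ≤ |f₀(ρ)|·S`.
We give the convenient form with the head enclosed by `tboundI`: `|f₀(ρ)| · S ≥ max(lo, −hi)`. [folklore] -/
theorem norm_evalC_ge_of_tpmem {S : ℕ} {h : ℚ} (h0 : 0 ≤ h) {f : ℝ → ℝ} {P : IPoly} {fs : List (ℝ → ℝ)} {Ps : TPoly}
    (hf : TMem S h f P) (hP : TPMem S h fs Ps) {ρ : ℝ} (hρ : |ρ| ≤ h) {Rn : ℤ} {Rd : ℕ} (hRn : 0 ≤ Rn) (hRd : 0 < Rd)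
    {t : ℂ} (ht : ‖t‖ ≤ (Rn : ℝ) / Rd) :
    ((max (tlowerI S h P) (-tupperI S h P) : ℤ) : ℝ) - (Rn : ℝ) / Rd * (absBoundI S Rn Rd (Ps.map (tboundI S h)) : ℝ)
      ≤ ‖evalC (evalAt ρ (f :: fs)) t‖ * S := by
  have hS0 : (0 : ℝ) ≤ S := by positivity
  have hR0 : (0 : ℝ) ≤ (Rn : ℝ) / Rd := by positivity
  have hlow := norm_evalC_cons_ge (f ρ) (evalAt ρ fs) ht
  -- `|f ρ| * S ≥ max lo (-hi)`
  have hhead : ((max (tlowerI S h P) (-tupperI S h P) : ℤ) : ℝ) ≤ |f ρ| * S := by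
    rw [Int.cast_max, Int.cast_neg]
    have hl := tlowerI_le h0 hf hρ
    have hu := le_tupperI h0 hf hρ
    rcases le_total 0 (f ρ) with hp | hn
    · rw [abs_of_nonneg hp]; exact max_le hl (by nlinarith)
    · rw [abs_of_nonpos hn]; exact max_le (by nlinarith) (by nlinarith)
  -- the tail
  have htail : absBoundR (evalAt ρ fs) ((Rn : ℝ) / Rd) * S ≤ (absBoundI S Rn Rd (Ps.map (tboundI S h)) : ℝ) :=
    absBoundR_le_absBoundI (S := S) hRn hRd (pmem_map_tboundI h0 hρ hP)
  rw [evalAt_cons] at *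
  have key : (|f ρ| - (Rn : ℝ) / Rd * absBoundR (evalAt ρ fs) ((Rn : ℝ) / Rd)) * S ≤ ‖evalC (f ρ :: evalAt ρ fs) t‖ * S :=
    mul_le_mul_of_nonneg_right hlow hS0
  have e : (|f ρ| - (Rn : ℝ) / Rd * absBoundR (evalAt ρ fs) ((Rn : ℝ) / Rd)) * S =
      |f ρ| * S - (Rn : ℝ) / Rd * (absBoundR (evalAt ρ fs) ((Rn : ℝ) / Rd) * S) := by ring
  rw [e] at key
  nlinarith [mul_le_mul_of_nonneg_left htail hR0]

end PolyMP

end Literature.Analysis.ValidatedNumerics
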